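import Literature.Computability.Complexity.TruthTableClosure
import Literature.Computability.Complexity.IterateFPPoly
import Literature.Computability.Complexity.BrickAlgebra
import Literature.Computability.Complexity.FPStringBricks
import HarnessLib

/-!
# Oracle algorithms presented as state machines: polynomial time from three `FP` maps

Trunk toolkit for the transcript model of oracle computation (`Oracle.lean`: an `OracleAlg β` is a
STEP FUNCTION `(input, answers so far) ↦ query | output`, polynomial time = `OracleAlg.IsPolyTime`,
i.e. the step function is an `FP` map of the code `⟨x, ⟨1^{#answers}, body answers⟩⟩`; `PRel`,
`FPRel`, and the C4a adversaries `Cryptography.OracleAdversary`). Writing an ADAPTIVE oracle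
procedure — one whose next query depends on all previous answers through some evolving
bookkeeping, e.g. the learning phase of Aaronson–Chen's `SampBPP^{TQBF,O}` simulator (CCC 2017,
§5.3: "we query all `x` with `Q(x) ≥ τ`", then "replace the `t`-th `O`-gate", then sample) —
directly as a step function means re-deriving, inside one `FP` proof, the whole bookkeeping from
the raw transcript. This file does that ONCE, for procedures given as a deterministic state
machine over string states:

* `OSM` — three string maps: `ini x` (initial state), `del ⟨x, ⟨st, [b]⟩⟩` (the state after the
  answer bit `b`), `kap ⟨x, st⟩` (the code of what to do in state `st`: `0 q` = ask `q`,
  `1 o` = output `o`); `OSM.state x bits` (fold of `del` over the answer bits), `OSM.alg`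
  (the oracle algorithm: decode `kap` at the state reached on the flattened answers),
  `OSM.loop` (the abstract interaction with a language oracle `A`, fuelled) and
  **`OSM.run_alg`**: `S.alg.run (Oracle.ofLanguage A) n x = S.loop A x n []`;
* **`OSM.isPolyTime_alg`**: if `ini, del, kap ∈ FP` and `|del ⟨x, ⟨st, [b]⟩⟩| ≤ |st| + G(|x|)`
  for a polynomial `G` (states grow additively per answer), then `S.alg.IsPolyTime (encodingList Bool)`
  — the step map re-runs the fold over the flattened answers (`flatT`, `TruthTableClosure.lean`)
  as a clocked loop of `|code|` rounds (`iterate_mem_FP_of_growth_poly`, `IterateFPPoly.lean`).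

## References

* S. Arora, B. Barak, *Computational Complexity: A Modern Approach*, CUP 2009, §3.4 (oracle
  machines), §1.3–1.4.1 (composition, clocked loops) [AroraBarakCC2009].
* R. E. Ladner, N. A. Lynch, A. L. Selman, TCS 1 (1975), §3 (adaptive = Turing reductions), as in
  `TruthTableClosure.lean` [LadnerLynchSelman1975].
* S. Aaronson, L. Chen, CCC 2017, §5.3 (pp. 22–23) [AaronsonChen2017] (the consumer in view).
-/

noncomputable section

namespace Literature.Computability.Complexity

open _root_.Computability Polynomial PRelSigma OracleCompose TTClosure Brick

/-- **A state machine presentation of an oracle algorithm** over string states: initial state,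
transition on one answer bit, and the action code of a state (`0 q`: query `q`; `1 o`: output `o`;
the input `x` is available to all three). [cite: AroraBarakCC2009, §3.4 (oracle machines)] -/
structure OSM where
  /-- `x ↦` initial state -/
  ini : List Bool → List Bool
  /-- `⟨x, ⟨st, [b]⟩⟩ ↦` state after the answer bit `b` -/
  del : List Bool → List Bool
  /-- `⟨x, st⟩ ↦` action code -/
  kap : List Bool → List Bool

/-- Decoding an action code: `0 q` is the query `q`, `1 o` the output `o` (and `ε` outputs `ε`). [folklore] -/
def decodeStep : List Bool → List Bool ⊕ List Bool
  | false :: q => Sum.inl q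
  | true :: o => Sum.inr o
  | [] => Sum.inr []

namespace OSM

variable (S : OSM)

/-- The state reached on input `x` after the answer bits `bits`. [folklore] -/
def state (x : List Bool) (bits : List Bool) : List Bool :=
  bits.foldl (fun st b => S.del (boolPair x (boolPair st [b]))) (S.ini x)

/-- `state` on no answers. [folklore] -/
@[simp] theorem state_nil (x : List Bool) : S.state x [] = S.ini x := rfl

/-- `state` after one more answer. [folklore] -/
theorem state_append_singleton (x bits : List Bool) (b : Bool) :
    S.state x (bits ++ [b]) = S.del (boolPair x (boolPair (S.state x bits) [b])) := by
  simp [state, List.foldl_append]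

/-- **The oracle algorithm of a state machine**: decode the action of the state reached on the
flattened answers. [cite: AroraBarakCC2009, §3.4] -/
def alg : OracleAlg (List Bool) where
  step x ans := decodeStep (S.kap (boolPair x (S.state x ans.flatten)))

/-- **The abstract interaction** with the language oracle `A`, with fuel: in state `st` (reached on
`bits`), a query `q` is answered by `[q ∈ A]` and appended, an output ends the run.
[cite: AroraBarakCC2009, §3.4] -/
def loop (A : Language Bool) (x : List Bool) : ℕ → List Bool → Option (List Bool)
  | 0, _ => none
  | n + 1, bits =>
    match decodeStep (S.kap (boolPair x (S.state x bits))) with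
    | Sum.inl q => loop A x n (bits ++ [A.boolIndicator q])
    | Sum.inr o => some o

/-- The fuelled runner on a one-bit transcript is the abstract loop. [folklore] -/
theorem runAux_alg (A : Language Bool) (x : List Bool) :
    ∀ (n : ℕ) (bits : List Bool), S.alg.runAux (Oracle.ofLanguage A) x n (bitsTrans bits) = S.loop A x n bits
  | 0, _ => rfl
  | n + 1, bits => by
    rw [OracleAlg.runAux_succ, loop]
    have hstep : S.alg.step x (bitsTrans bits) = decodeStep (S.kap (boolPair x (S.state x bits))) := by
      simp [alg]
    rw [hstep]
    rcases decodeStep (S.kap (boolPair x (S.state x bits))) with q | o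
    · simp only
      rw [← runAux_alg A x n (bits ++ [A.boolIndicator q]), bitsTrans_append, bitsTrans_singleton,
        Oracle.ofLanguage_apply]
      rfl
    · rfl

/-- **The run of the algorithm is the abstract loop**: `S.alg.run A n x = S.loop A x n []`.
[cite: AroraBarakCC2009, §3.4] -/
theorem run_alg (A : Language Bool) (n : ℕ) (x : List Bool) : S.alg.run (Oracle.ofLanguage A) n x = S.loop A x n [] :=
  S.runAux_alg A x n []

/-- More fuel does not change a produced output. [folklore] -/
theorem loop_mono (A : Language Bool) (x : List Bool) {n n' : ℕ} (h : n ≤ n') {bits : List Bool} {o : List Bool}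
    (ho : S.loop A x n bits = some o) : S.loop A x n' bits = some o := by
  rw [← runAux_alg] at ho ⊢
  exact S.alg.runAux_mono _ x h ho

/-! ### Polynomial time -/

section PolyTime

/-- The flattened answers are not longer than the body of their code. [folklore] -/
theorem length_flatten_le_body : ∀ t : List (List Bool), t.flatten.length ≤ (body t).length
  | [] => by simp
  | a :: t => by
    rw [List.flatten_cons, List.length_append, body_cons, length_boolPair]
    have := length_flatten_le_body t
    omega

/-- The input `x` read off the code `⟨x, ⟨1^{#answers}, body⟩⟩`. [folklore] -/
def xS : List Bool → List Bool := fstP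
/-- The flattened answer bits read off the code. [folklore] -/
def bitsS : List Bool → List Bool := flatT.eval ∘ sndP ∘ sndP

/-- `xS ∈ FP`. [folklore] -/
theorem xS_mem_FP : xS ∈ FP := fstP_mem_FP
/-- `bitsS ∈ FP`. [folklore] -/
theorem bitsS_mem_FP : bitsS ∈ FP := comp_mem_FP flatT_mem_FP (comp_mem_FP sndP_mem_FP sndP_mem_FP)

/-- `xS` on a code. [folklore] -/
theorem xS_apply (x : List Bool) (ans : List (List Bool)) : xS (boolPair x ((encodingList Bool).listBool.encode ans)) = x :=
  fstP_boolPair _ _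

/-- `bitsS` on a code. [folklore] -/
theorem bitsS_apply (x : List Bool) (ans : List (List Bool)) :
    bitsS (boolPair x ((encodingList Bool).listBool.encode ans)) = ans.flatten := by
  simp [bitsS, code_eq_boolPair, flatT_eval_body]

/-- The loop record `⟨v, ⟨unread bits, state⟩⟩` of the re-run fold (`v` the whole code, kept as the
yardstick). [folklore] -/
def mkL (v bs st : List Bool) : List Bool := boolPair v (boolPair bs st)

/-- One round of the re-run fold: consume one answer bit. [folklore] -/
def roundS : List Bool → List Bool :=
  iteFn (isNilFn ∘ nthF 1) id
    (fanoutFn fstF (fanoutFn (List.tail ∘ nthF 1)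
      (S.del ∘ fanoutFn (xS ∘ fstF) (fanoutFn (sndPow 1) (take1Fn ∘ nthF 1)))))

/-- `roundS ∈ FP`. [folklore] -/
theorem roundS_mem_FP (hdel : S.del ∈ FP) : S.roundS ∈ FP :=
  iteFn_mem_FP (comp_mem_FP isNilFn_mem_FP (nthF_mem_FP 1)) OracleCompose.id_mem_FP
    (fanoutFn_mem_FP fstF_mem_FP (fanoutFn_mem_FP (comp_mem_FP PRelSigma.tail_mem_FP (nthF_mem_FP 1))
      (comp_mem_FP hdel (fanoutFn_mem_FP (comp_mem_FP xS_mem_FP fstF_mem_FP)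
        (fanoutFn_mem_FP (sndPow_mem_FP 1) (comp_mem_FP take1Fn_mem_FP (nthF_mem_FP 1)))))))

/-- The round on an exhausted record. [folklore] -/
theorem roundS_nil (v st : List Bool) : S.roundS (mkL v [] st) = mkL v [] st := by
  rw [roundS, iteFn_apply_true (by simp [mkL, isNilFn])]
  rfl

/-- The round consumes one bit. [folklore] -/
theorem roundS_cons (v : List Bool) (b : Bool) (bs st : List Bool) :
    S.roundS (mkL v (b :: bs) st) = mkL v bs (S.del (boolPair (xS v) (boolPair st [b]))) := by
  rw [roundS, iteFn_apply_false (by simp [mkL, isNilFn])]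
  simp [mkL, take1Fn]

/-- Iterating the round folds `del` over the bits. [folklore] -/
theorem iterate_roundS (v : List Bool) : ∀ (bs st : List Bool) (n : ℕ), bs.length ≤ n →
    S.roundS^[n] (mkL v bs st) = mkL v [] (bs.foldl (fun st b => S.del (boolPair (xS v) (boolPair st [b]))) st)
  | [], st, n, _ => Function.iterate_fixed (S.roundS_nil v st) n
  | b :: bs, st, 0, h => by simp at h
  | b :: bs, st, n + 1, h => by
    rw [Function.iterate_succ_apply, roundS_cons, iterate_roundS v bs _ n (by simpa using h), List.foldl_cons]

/-- The round keeps the yardstick. [folklore] -/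
theorem fstF_roundS (w : List Bool) : (boolUnpair (S.roundS w)).1 = (boolUnpair w).1 := by
  rw [roundS, iteFn_of_oneBit (oneBit_isNilFn.comp _)]
  split_ifs
  · rfl
  · show (boolUnpair (fanoutFn fstF _ w)).1 = _
    rw [fanoutFn_apply, boolUnpair_boolPair]
    rfl

variable {G : Polynomial ℕ}

/-- **Growth of one round** under the additive state-growth hypothesis (the `+ 2` pays for the
pair separators a malformed input may lack). [folklore] -/
theorem length_roundS_le (hG : ∀ x st : List Bool, ∀ b : Bool, (S.del (boolPair x (boolPair st [b]))).length ≤ st.length + G.eval x.length)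
    (w : List Bool) : (S.roundS w).length ≤ w.length + (G + 2).eval (boolUnpair w).1.length := by
  rw [roundS, iteFn_of_oneBit (oneBit_isNilFn.comp _)]
  split_ifs with h
  · simp
  · -- `w` read as `⟨v, ⟨bs, st⟩⟩`
    have h0 := length_fstF_sndF_le w
    have h1 : 2 * (nthF 1 w).length + (sndPow 1 w).length ≤ (sndF w).length := by
      simpa [Brick.sndPow_zero] using length_nthF_succ_add_sndPow_succ_le 0 w
    have hx : (xS (fstF w)).length ≤ (fstF w).length := by
      have := length_boolUnpair_parts_le (fstF w)
      change (boolUnpair (fstF w)).1.length ≤ (fstF w).length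
      omega
    have hne : nthF 1 w ≠ [] := by simpa [isNilFn] using h
    have hb : ∃ b : Bool, take1Fn (nthF 1 w) = [b] := by
      rcases hq : nthF 1 w with _ | ⟨b, l⟩
      · exact absurd hq hne
      · exact ⟨b, rfl⟩
    obtain ⟨b, hb⟩ := hb
    have hm : 1 ≤ (nthF 1 w).length := by
      rcases hq : nthF 1 w with _ | ⟨b, l⟩
      · exact absurd hq hne
      · simp
    simp only [fanoutFn_apply, Function.comp_apply, hb, length_boolPair, List.length_tail]
    have hd := hG (xS (fstF w)) (sndPow 1 w) b
    have hmono := TM2Iter.eval_mono G hx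
    change _ ≤ w.length + (G + 2).eval (fstF w).length
    rw [eval_add, eval_ofNat]
    omega

/-- The re-run fold of the whole code: `|v|` rounds from `⟨v, ⟨bits v, ini (x v)⟩⟩`. [folklore] -/
def foldS : List Bool → List Bool := fun z => S.roundS^[(X : Polynomial ℕ).eval (boolUnpair z).1.length] z

/-- The initial loop record of a code. [folklore] -/
def initL : List Bool → List Bool := fanoutFn id (fanoutFn bitsS (S.ini ∘ xS))

/-- The state reached on the code's answers. [folklore] -/
def stateS : List Bool → List Bool := sndPow 1 ∘ S.foldS ∘ S.initL

/-- The step map: the (normalised) action code of the state reached. [folklore] -/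
def stepS : List Bool → List Bool :=
  iteFn (isNilFn ∘ (S.kap ∘ fanoutFn xS S.stateS)) (fun _ => [true]) (S.kap ∘ fanoutFn xS S.stateS)

/-- `foldS ∈ FP` under the growth hypothesis. [cite: AroraBarakCC2009, §1.4.1 (clocked loops)] -/
theorem foldS_mem_FP (hdel : S.del ∈ FP)
    (hG : ∀ x st : List Bool, ∀ b : Bool, (S.del (boolPair x (boolPair st [b]))).length ≤ st.length + G.eval x.length) :
    S.foldS ∈ FP :=
  iterate_mem_FP_of_growth_poly (S.roundS_mem_FP hdel) (G + 2) (S.fstF_roundS) (S.length_roundS_le hG) X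

/-- `initL ∈ FP`. [folklore] -/
theorem initL_mem_FP (hini : S.ini ∈ FP) : S.initL ∈ FP :=
  fanoutFn_mem_FP OracleCompose.id_mem_FP (fanoutFn_mem_FP bitsS_mem_FP (comp_mem_FP hini xS_mem_FP))

/-- `stateS ∈ FP`. [folklore] -/
theorem stateS_mem_FP (hini : S.ini ∈ FP) (hdel : S.del ∈ FP)
    (hG : ∀ x st : List Bool, ∀ b : Bool, (S.del (boolPair x (boolPair st [b]))).length ≤ st.length + G.eval x.length) :
    S.stateS ∈ FP :=
  comp_mem_FP (sndPow_mem_FP 1) (comp_mem_FP (S.foldS_mem_FP hdel hG) (S.initL_mem_FP hini))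

/-- `stepS ∈ FP`. [folklore] -/
theorem stepS_mem_FP (hini : S.ini ∈ FP) (hdel : S.del ∈ FP) (hkap : S.kap ∈ FP)
    (hG : ∀ x st : List Bool, ∀ b : Bool, (S.del (boolPair x (boolPair st [b]))).length ≤ st.length + G.eval x.length) :
    S.stepS ∈ FP :=
  iteFn_mem_FP (comp_mem_FP isNilFn_mem_FP (comp_mem_FP hkap (fanoutFn_mem_FP xS_mem_FP (S.stateS_mem_FP hini hdel hG))))
    (const_mem_FP _) (comp_mem_FP hkap (fanoutFn_mem_FP xS_mem_FP (S.stateS_mem_FP hini hdel hG)))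

/-- **The state map computes the state.** [folklore] -/
theorem stateS_apply (x : List Bool) (ans : List (List Bool)) :
    S.stateS (boolPair x ((encodingList Bool).listBool.encode ans)) = S.state x ans.flatten := by
  set v := boolPair x ((encodingList Bool).listBool.encode ans) with hv
  have hx : xS v = x := by rw [hv]; exact xS_apply x ans
  have hb : bitsS v = ans.flatten := by rw [hv]; exact bitsS_apply x ans
  have hlen : ans.flatten.length ≤ v.length := by
    rw [hv, code_eq_boolPair, length_boolPair, length_boolPair]
    have := length_flatten_le_body ans
    omega
  have hinit : S.initL v = mkL v ans.flatten (S.ini x) := by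
    rw [initL, fanoutFn_apply, fanoutFn_apply, hb, Function.comp_apply, hx]; rfl
  have hcount : (X : Polynomial ℕ).eval (boolUnpair (mkL v ans.flatten (S.ini x))).1.length = v.length := by
    simp [mkL]
  rw [stateS, Function.comp_apply, Function.comp_apply, foldS, hinit, hcount,
    S.iterate_roundS v ans.flatten (S.ini x) _ hlen, mkL]
  simp only [sndPow_succ_boolPair, sndPow_zero_boolPair, state, hx]

/-- The code of the step result. [folklore] -/
theorem stepS_apply (x : List Bool) (ans : List (List Bool)) :
    S.stepS (boolPair x ((encodingList Bool).listBool.encode ans)) =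
      ((encodingList Bool).sumBool (encodingList Bool)).encode (S.alg.step x ans) := by
  set v := boolPair x ((encodingList Bool).listBool.encode ans) with hv
  have hk : (S.kap ∘ fanoutFn xS S.stateS) v = S.kap (boolPair x (S.state x ans.flatten)) := by
    rw [Function.comp_apply, fanoutFn_apply, hv, xS_apply, stateS_apply]
  have hstep : S.alg.step x ans = decodeStep (S.kap (boolPair x (S.state x ans.flatten))) := rfl
  rw [stepS, hstep]
  rcases hc : S.kap (boolPair x (S.state x ans.flatten)) with _ | ⟨_ | _, l⟩
  · rw [iteFn_apply_true (by rw [Function.comp_apply, hk, hc]; rfl)]; rfl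
  · rw [iteFn_apply_false (by rw [Function.comp_apply, hk, hc]; rfl), hk, hc]; rfl
  · rw [iteFn_apply_false (by rw [Function.comp_apply, hk, hc]; rfl), hk, hc]; rfl

/-- **A state machine with `FP` maps and additively growing states is a polynomial-time oracle
algorithm.** [cite: AroraBarakCC2009, §3.4 with §1.4.1] -/
theorem isPolyTime_alg (hini : S.ini ∈ FP) (hdel : S.del ∈ FP) (hkap : S.kap ∈ FP)
    (hG : ∀ x st : List Bool, ∀ b : Bool, (S.del (boolPair x (boolPair st [b]))).length ≤ st.length + G.eval x.length) :
    S.alg.IsPolyTime (encodingList Bool) := by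
  obtain ⟨p, Mx, h⟩ := S.stepS_mem_FP hini hdel hkap hG
  refine ⟨p, Mx, fun z => ?_⟩
  have hz := h (boolPair z.1 ((encodingList Bool).listBool.encode z.2))
  rw [id, stepS_apply] at hz
  exact hz

end PolyTime

end OSM

end Literature.Computability.Complexity

end
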